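import Summits.FinalStateConjecture.FinalStateConjecture.Theses.ClusterCompleteness
import Summits.FinalStateConjecture.FinalStateConjecture.Theorems.ClusterCompletenessLinearToNonlinearCaptureTwoPinsDefs
import Summits.FinalStateConjecture.FinalStateConjecture.Theorems.ClusterCompletenessLinearToNonlinearCaptureTwoPinsTimeShift
import HarnessLib

/-!
# Crux `LinearToNonlinearCapture` (stmt-FinalStateConjecture-14526), line `two-pins-and-completeness` —
# stub `stub_scalarRateFreeDecay`

The registered stub S1 of the skeleton `LinearToNonlinearCapture` (route `ClusterCompleteness`):
the engine `AdiabaticMultiKerrILED` (uniform energy boundedness + integrated local energy decay with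
loss of one derivative for scalar waves on strictly receding, tails-cut patched multi-Kerr
backgrounds) implies the MODEL statement `ScalarRateFreeDecay` (`…TwoPinsDefs.lean`): rate-free decay
of the local energy `∫_{‖y‖ ≤ R, ext} Σ(∂ψ)²(t, y) dy → 0` of every smooth finite-energy solution.

Proof. Witnesses `d₀ = max d₀' 40`, `α = min α' 1/2`, `v₀ = min v₀' 1/2` (`(d₀', α', v₀')` the
engine's witnesses), so that every configuration satisfies both the engine's hypotheses and the tree
lemmas' (`40`, `1/2`, `1/2`). For a configuration, `G`, `E`, `R` and a solution `ψ` with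
`E ψ 0, E ∂₀ψ 0 < ∞`: (b) of the engine at radius `R + 2` gives
`∫_{t>0} f_{R+2}(t) dt ≤ C (E ψ 0 + E ∂₀ψ 0) < ∞`; the local energy propagation uniform in the base
time (`srfd_localEnergyShift`, `…TwoPinsTimeShift.lean`: domain of dependence on the patched
background, configuration translated in time) gives `f_R(t) ≤ K f_{R+2}(s)` for
`0 ≤ s ≤ t ≤ s + 1`; and the tail lemma `srfd_tendsto_zero_of_lintegral_ne_top` (`ℝ≥0∞`-valued
Barbalat: `f t ≤ K ∫_{t−1}^t g ≤ K ∫_{s > n} g → 0`, no measurability of `g` needed) concludes.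
Mechanism as in Dafermos–Rodnianski arXiv:0811.0354, §3–§4; Hawking–Ellis 1973, §4.3. [folklore]
-/

-- the doubled `FinalStateConjecture.FinalStateConjecture` path component trips dupNamespace
set_option linter.dupNamespace false
noncomputable section
open scoped BigOperators Topology Manifold ENNReal ContDiff InnerProductSpace RealInnerProductSpace
open Filter Set Function TopologicalSpace MeasureTheory
namespace Summit.FinalStateConjecture.FinalStateConjecture.Theorems.ClusterCompleteness.TwoPins
open Literature.Geometry.Lorentzian
open Summit.FinalStateConjecture.FinalStateConjecture.Theorems.ClusterCompleteness
open Summit.FinalStateConjecture.FinalStateConjecture.Theses.ClusterCompleteness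

/-- **Tail lemma (Barbalat type, `ℝ≥0∞`-valued).** If `f t ≤ K g s` whenever
`0 ≤ s ≤ t ≤ s + 1`, with `K < ∞` and `∫_{s>0} g s ds < ∞`, then `f t → 0` as `t → ∞`:
`f t ≤ K ∫_{t−1}^{t} g ≤ K ∫_{s>n} g` for `t ≥ n + 2`, and the tails of a finite integral tend to
`0` (no measurability of `g` is needed: the lower Lebesgue integral is monotone and additive in the
domain, and continuous along increasing unions). [folklore] -/
private theorem srfd_tendsto_zero_of_lintegral_ne_top {f g : ℝ → ℝ≥0∞} {K : ℝ≥0∞} (hK : K ≠ ⊤)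
    (hfg : ∀ s t : ℝ, 0 ≤ s → s ≤ t → t ≤ s + 1 → f t ≤ K * g s)
    (hg : ∫⁻ s in Ioi (0 : ℝ), g s ≠ ⊤) : Tendsto f atTop (𝓝 0) := by
  set I : ℝ≥0∞ := ∫⁻ s in Ioi (0 : ℝ), g s with hI
  set F : ℕ → ℝ≥0∞ := fun n ↦ ∫⁻ s in Ioc (0 : ℝ) n, g s with hF
  -- the truncated integrals increase to `I`
  have hSmono : Monotone fun n : ℕ ↦ Ioc (0 : ℝ) n := fun m n hmn ↦
    Ioc_subset_Ioc_right (by exact_mod_cast hmn)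
  have hFmono : Monotone F := fun m n hmn ↦ lintegral_mono_set (hSmono hmn)
  have hUnion : (⋃ n : ℕ, Ioc (0 : ℝ) n) = Ioi 0 := by
    ext s
    simp only [mem_iUnion, mem_Ioc, mem_Ioi]
    constructor
    · rintro ⟨n, hs, -⟩; exact hs
    · intro hs
      obtain ⟨n, hn⟩ := exists_nat_ge s
      exact ⟨n, hs, hn⟩
  have hFsup : (⨆ n, F n) = I := by
    rw [hI, ← hUnion, setLIntegral_iUnion_of_directed _ hSmono.directed_le]
  have hFlim : Tendsto F atTop (𝓝 I) := hFsup ▸ tendsto_atTop_iSup hFmono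
  -- the tails `I - F n` tend to `0`, and so does `K (I - F n)`
  have htail : Tendsto (fun n ↦ K * (I - F n)) atTop (𝓝 0) := by
    have h1 : Tendsto (fun n ↦ I - F n) atTop (𝓝 (I - I)) :=
      ENNReal.Tendsto.sub tendsto_const_nhds hFlim (Or.inl hg)
    rw [tsub_self] at h1
    have h2 := ENNReal.Tendsto.const_mul h1 (Or.inr hK)
    rwa [mul_zero] at h2
  -- the tail beyond `n` is `I - F n`
  have hsplit : ∀ n : ℕ, ∫⁻ s in Ioi (n : ℝ), g s = I - F n := by
    intro n
    have hn : (0 : ℝ) ≤ n := n.cast_nonneg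
    have hu : Ioc (0 : ℝ) n ∪ Ioi (n : ℝ) = Ioi 0 := Ioc_union_Ioi_eq_Ioi hn
    have hdisj : Disjoint (Ioc (0 : ℝ) n) (Ioi (n : ℝ)) := fun u h1 h2 x hx ↦
      absurd (h2 hx) (not_lt.mpr (h1 hx).2)
    have hadd : F n + ∫⁻ s in Ioi (n : ℝ), g s = I := by
      rw [hI, ← hu, lintegral_union measurableSet_Ioi hdisj]
    have hFn : F n ≠ ⊤ := ne_top_of_le_ne_top hg (hadd ▸ le_self_add)
    rw [add_comm] at hadd
    exact ENNReal.eq_sub_of_add_eq hFn hadd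
  -- `f t ≤ K (I - F n)` for `t ≥ n + 2`
  have hbound : ∀ (n : ℕ) (t : ℝ), (n : ℝ) + 2 ≤ t → f t ≤ K * (I - F n) := by
    intro n t ht
    have hn : (0 : ℝ) ≤ n := n.cast_nonneg
    have hvol : volume (Icc (t - 1) t) = 1 := by
      rw [Real.volume_Icc, show t - (t - 1) = 1 by ring, ENNReal.ofReal_one]
    have h1 : f t = ∫⁻ _ in Icc (t - 1) t, f t := by
      rw [setLIntegral_const, hvol, mul_one]
    have h2 : ∫⁻ _ in Icc (t - 1) t, f t ≤ ∫⁻ s in Icc (t - 1) t, K * g s :=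
      setLIntegral_mono' measurableSet_Icc fun s hs ↦
        hfg s t (by linarith [hs.1]) hs.2 (by linarith [hs.1])
    have h3 : ∫⁻ s in Icc (t - 1) t, K * g s = K * ∫⁻ s in Icc (t - 1) t, g s :=
      lintegral_const_mul' K _ hK
    have h4 : ∫⁻ s in Icc (t - 1) t, g s ≤ ∫⁻ s in Ioi (n : ℝ), g s :=
      lintegral_mono_set fun s hs ↦ by
        simp only [mem_Ioi]
        linarith [hs.1]
    rw [h1, ← hsplit n]
    exact h2.trans (h3.le.trans (mul_le_mul_right h4 K))
  -- conclusion
  rw [ENNReal.tendsto_nhds_zero]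
  intro ε hε
  obtain ⟨n, hn⟩ := ENNReal.tendsto_atTop_zero.mp htail ε hε
  exact eventually_atTop.mpr ⟨(n : ℝ) + 2, fun t ht ↦ (hbound n t ht).trans (hn n le_rfl)⟩

/-- **S1: the engine implies rate-free local energy decay on its own background.** Witnesses
`(max d₀' 40, min α' 1/2, min v₀' 1/2)`; for a configuration, radius `R` and a smooth solution `ψ`
with finite `E ψ 0`, `E ∂₀ψ 0`: (b) of `AdiabaticMultiKerrILED` at radius `R + 2` makes
`t ↦ f_{R+2}(t)` integrable on `(0, ∞)`, the local propagation estimate `srfd_localEnergyShift`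
(uniform in the base time) gives `f_R(t) ≤ K f_{R+2}(s)` on `[t − 1, t]`, and the tail lemma
`srfd_tendsto_zero_of_lintegral_ne_top` yields `f_R(t) → 0`. Dafermos–Rodnianski
arXiv:0811.0354, §3–§4 (energy estimates outside a future horizon); Hawking–Ellis 1973, §4.3,
Lemma 4.3.1. [folklore] -/
theorem stub_scalarRateFreeDecay : AdiabaticMultiKerrILED → ScalarRateFreeDecay := by
  intro hA N
  obtain ⟨d₀', α', v₀', hd₀', hα', hv₀', hA'⟩ := hA N
  refine ⟨max d₀' 40, min α' 2⁻¹, min v₀' 2⁻¹, lt_max_of_lt_left hd₀', lt_min hα' (by norm_num),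
    lt_min hv₀' (by norm_num), ?_⟩
  intro M a Λ p u q hu hq hM ha hv hsep G hG E hE R ψ hψ hsol hE0 hE1
  -- ### the configuration satisfies the engine's hypotheses and the tree lemmas' hypotheses
  have ha2 : ∀ i, |a i| ≤ α' * M i := fun i ↦
    (ha i).trans (mul_le_mul_of_nonneg_right (min_le_left _ _) (hM i).le)
  have ha1 : ∀ i, |a i| ≤ 2⁻¹ * M i := fun i ↦
    (ha i).trans (mul_le_mul_of_nonneg_right (min_le_right _ _) (hM i).le)
  have hv2 : ∀ i, 0 < u i 0 ∧ ‖E4.spatial (u i)‖ ≤ v₀' * u i 0 := fun i ↦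
    ⟨(hv i).1, (hv i).2.trans (mul_le_mul_of_nonneg_right (min_le_left _ _) (hv i).1.le)⟩
  have hv1 : ∀ i, 0 < u i 0 ∧ ‖E4.spatial (u i)‖ ≤ 2⁻¹ * u i 0 := fun i ↦
    ⟨(hv i).1, (hv i).2.trans (mul_le_mul_of_nonneg_right (min_le_right _ _) (hv i).1.le)⟩
  have hMM : ∀ i j, 0 ≤ M i + M j := fun i j ↦ by linarith [hM i, hM j]
  have hsep2 : ∀ i j, i ≠ j → d₀' * (M i + M j) ≤ dist (p i) (p j) ∧
      0 < ⟪p i - p j, (u i 0)⁻¹ • E4.spatial (u i) - (u j 0)⁻¹ • E4.spatial (u j)⟫_ℝ :=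
    fun i j hij ↦ ⟨(mul_le_mul_of_nonneg_right (le_max_left _ _) (hMM i j)).trans
      (hsep i j hij).1, (hsep i j hij).2⟩
  have hsep1 : ∀ i j, i ≠ j → 40 * (M i + M j) ≤ dist (p i) (p j) ∧
      0 < ⟪p i - p j, (u i 0)⁻¹ • E4.spatial (u i) - (u j 0)⁻¹ • E4.spatial (u j)⟫_ℝ :=
    fun i j hij ↦ ⟨(mul_le_mul_of_nonneg_right (le_max_right _ _) (hMM i j)).trans
      (hsep i j hij).1, (hsep i j hij).2⟩
  -- ### (b) of the engine at radius `R + 2`: the local energy is integrable in time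
  obtain ⟨C, hC⟩ := hA' M a Λ p u q hu hq hM ha2 hv2 hsep2 G hG E hE (R + 2)
  obtain ⟨-, hb⟩ := hC ψ hψ hsol
  have hfin : (C : ℝ≥0∞) * (E ψ 0 + E (fun x ↦ fderiv ℝ ψ x (E4.basisVector 0)) 0) ≠ ⊤ :=
    ENNReal.mul_ne_top ENNReal.coe_ne_top (ENNReal.add_ne_top.mpr ⟨hE0, hE1⟩)
  -- ### local propagation, uniform in the base time, and the tail lemma
  obtain ⟨K, hK, hprop⟩ := srfd_localEnergyShift M a Λ p u q hu hq hM ha1 hv1 hsep1 G hG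
  exact srfd_tendsto_zero_of_lintegral_ne_top
    (g := fun s ↦ ∫⁻ y in {y : E3 | ‖y‖ ≤ R + 2 ∧ ∀ i, Kerr.rPlus (M i) (a i) <
        Kerr.radius (a i) (q i (E4.ofTimeSpace s y))},
      ENNReal.ofReal (∑ μ : Fin 4, (fderiv ℝ ψ (E4.ofTimeSpace s y) (E4.basisVector μ)) ^ 2))
    hK (fun s t hs hst hts ↦ hprop ψ hψ hsol R s t hs hst hts) (ne_top_of_le_ne_top hfin hb)

end Summit.FinalStateConjecture.FinalStateConjecture.Theorems.ClusterCompleteness.TwoPins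
end
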